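import Mathlib
import Summits.ResolutionOfSingularities.ResolutionOfSingularities.Theorems.WeightedInvariantLocalWeightedDropNCResApexColumnPosB
import Summits.ResolutionOfSingularities.ResolutionOfSingularities.Theorems.WeightedInvariantLocalWeightedDropNCResBadDirPosB
import Summits.ResolutionOfSingularities.ResolutionOfSingularities.Theorems.WeightedInvariantLocalWeightedDropNCResSurfaceBoundaryNCThreeB

/-!
# `WeightedInvariant.LocalWeightedDrop` ENGINE, W′|₄ line — D₃ᴮ object (14): THE `o = 1` PHASE FROM THE REGIMES — THE ENDGAME DISSOLVED (hand D, 3/3)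

Sub-problem `ResolutionOfSingularities`, ENGINE crux `stmt-ResolutionOfSingularities-8899` (`LocalWeightedDrop`), registered stub W′|₄
`stub_wildWideApexFourStartsWon`; res-L1-w43-plan-1 RULING 2026-08-27T21:45:42Z (D₃ᴮ lane), hand D.  [OURS · L1 W4.3 · chain w43 · res-L1-w43-lead-1 g6;
def-free; nothing here is a statement of any manuscript; AI-produced, gate-checked, weaker than expert review.]

FINDING (lead-1 g6, 2026-08-27T23:30Z).  The `o ≤ 1` endgame of D₃ᴮ is not a separate game: at `o = 0` the position is a normal crossing (T0); at
`o = 1` the regime split holds (`Decoration.regime_split₁`), regime (H) holds (`regimeApexColumnB₁`), regime (B) holds (`regimeBadB₁`), a GOOD POSITION IS A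
NORMAL CROSSING (`germIsNC_of_goodDir_of_o_eq_one`: the directrix form IS the linear form of `f`, so a free letter carries a linear coefficient — (T1)), and
the same fixed-head induction as in the `o ≥ 2` phase assembles them.  WHAT REMAINS OF D₃ᴮ, EXACTLY: the `o = 1` forms of regime (P) for a NON-EMPTY HISTORY
and of regime (L):

* `hP₁ : ∀ b δ, Admissible b δ → δ.o = 1 → ¬ δ.HCol → δ.O.Nonempty → DBWinsTo «admissible ∧ (head drop ∨ (same head ∧ HCol))» (b, δ)`,
* `hL₁ : ∀ b δ l, Admissible b δ → δ.o = 1 → ¬ δ.HCol → δ.LetterDir l → DBWinsTo «admissible ∧ (head drop ∨ (same head ∧ (HCol ∨ GoodDir ∨ BadDir)))» (b, δ)`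

(the polygon game of the `o ≥ 2` phase at degree `d = c = 1 + |O|`; its D-form proofs use `2 ≤ o` genuinely in `Decoration.newtonSet_nonempty_of_presentation`
(…TOT2BridgePresentedExit: at `o = 1` an empty Newton set is a NORMAL-CROSSING EXIT, not a contradiction), in `…NCBranchPrimesPresented` (`2 ≤ d`) and in
`…NCResRegimeLetterReading`; everywhere else through `0 < d` only).

* `germIsNC_of_goodDir_of_o_eq_one` — (T1) at a good position of order one;
* `onePhaseB_of_step`, **`onePhaseB_of_regimes`** — the `o = 1` phase: from every admissible state of order one the mover B-forces «NC, or admissible of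
  smaller head», given (H₁) (P₁) (L₁) (B₁);
* `endPhaseB_of_onePhase` — the `o ≤ 1` endgame `hend` of `surfaceBoundaryNC_of_regimesB` from the `o = 1` phase;
* **`surfaceBoundaryNC_of_regimesPL₁`**, **`surfaceBoundaryNC₃_of_regimesPL₁`** — D₃ᴮ / res-L1-w43-strat-1's `stub_surfaceBoundaryNC₃` MODULO `hP₁`, `hL₁` ONLY.
-/

set_option linter.dupNamespace false -- mandated namespace of this single-conjunct summit

noncomputable section

namespace Summit.ResolutionOfSingularities.ResolutionOfSingularities.Theorems

namespace TameFourTupleDrop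

open MvPowerSeries Literature.AlgebraicGeometry.Resolution

variable {k : Type} [Field k] {m : ℕ}

/-! ## A good position of order one is a normal crossing -/

/-- **(T1) AT A GOOD POSITION OF ORDER ONE**: with `o = 1` and `O = ∅` the degree-`c = 1` form of the product is the linear form of `f`, so a directrix form
with a free letter is a non-zero linear coefficient of `f` at a letter outside the boundary — the position is a normal crossing. -/
theorem germIsNC_of_goodDir_of_o_eq_one {b : MvPowerSeries (Fin (m + 1)) k} {δ : Decoration k m} (hadm : Admissible b δ) (ho : δ.o = 1)
    (hgood : δ.GoodDir) : GermIsNC b := by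
  classical
  obtain ⟨hO, ℓ, hℓ, j, hj, hℓj⟩ := hgood
  have hc : δ.c = 1 := by rw [Decoration.c, hO, Finset.card_empty, add_zero, ho]
  have hcoeff : coeff (Finsupp.single j 1) δ.f ≠ 0 := by
    intro h0
    refine hℓj ((hℓ.apply_eq_zero_iff_coeff (by rw [hc]; exact one_ne_zero) j).mpr ?_)
    rw [hO, Finset.prod_empty, mul_one, hc]
    exact h0
  exact germIsNC_of_admissible_of_linear_free_letter hadm hj (δ.constantCoeff_f_eq_zero_of_o_ne_zero (by omega)) hcoeff

/-! ## The `o = 1` phase: the fixed-head induction with the normal-crossing exit -/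

/-- **THE INNER INDUCTION OF THE `o = 1` PHASE, B-form** (secondary measure `ν` in any well-founded order; targets may exit by a normal crossing). -/
theorem onePhaseB_of_step {α : Type} [LT α] [WellFoundedLT α] (ν : MvPowerSeries (Fin (m + 1)) k × Decoration k m → α)
    (hstep : ∀ (b : MvPowerSeries (Fin (m + 1)) k) (δ : Decoration k m), Admissible b δ → δ.o = 1 →
      DBWinsTo (fun τ => GermIsNC τ.1 ∨ (Admissible τ.1 τ.2 ∧ (τ.2.head < δ.head ∨ (τ.2.head = δ.head ∧ ν τ < ν (b, δ))))) (b, δ))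
    (b : MvPowerSeries (Fin (m + 1)) k) (δ : Decoration k m) (hadm : Admissible b δ) (ho : δ.o = 1) :
    DBWinsTo (fun τ => GermIsNC τ.1 ∨ (Admissible τ.1 τ.2 ∧ τ.2.head < δ.head)) (b, δ) := by
  suffices H : ∀ (a : α) (b' : MvPowerSeries (Fin (m + 1)) k) (δ' : Decoration k m), ν (b', δ') = a → Admissible b' δ' →
      δ'.head = δ.head → DBWinsTo (fun τ => GermIsNC τ.1 ∨ (Admissible τ.1 τ.2 ∧ τ.2.head < δ.head)) (b', δ') from H _ b δ rfl hadm rfl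
  intro a
  induction a using WellFoundedLT.induction with
  | ind a ih =>
    intro b' δ' ha hadm' hh
    subst ha
    have ho' : δ'.o = 1 := by
      have hh' := hh
      rw [Decoration.head, Decoration.head, toLex_inj] at hh'
      have hoo : δ'.o = δ.o := (Prod.ext_iff.mp hh').1
      rw [hoo]
      exact ho
    refine (hstep b' δ' hadm' ho').bind fun τ hτ => ?_
    rcases hτ with hnc | ⟨hadmτ, hlt | ⟨heq, hν⟩⟩
    · exact DBWinsTo.of_target (Or.inl hnc)
    · exact DBWinsTo.of_target (Or.inr ⟨hadmτ, hh ▸ hlt⟩)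
    · exact ih (ν τ) hν τ.1 τ.2 rfl hadmτ (heq.trans hh)

/-- **THE `o = 1` PHASE FROM THE FOUR REGIMES AT ORDER ONE, B-form** (three letters, `k` infinite): from every admissibly decorated position of order one the
mover B-forces «normal crossing, or admissibly decorated of strictly smaller head» — given regime (H) and regime (B) at order one (tree theorems
`regimeApexColumnB₁`, `regimeBadB₁`), regime (P) at order one for a NON-EMPTY history and regime (L) at order one; a good position exits by (T1).  (Regime
rank: apex column 0, history 1, bad position 2, letter directrix 3; the same-head successors always have smaller rank or are normal crossings.) -/
theorem onePhaseB_of_regimes [Infinite k]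
    (hH : ∀ (b : MvPowerSeries (Fin (2 + 1)) k) (δ : Decoration k 2), Admissible b δ → δ.o = 1 → δ.HCol →
      DBWinsTo (fun τ => Admissible τ.1 τ.2 ∧ τ.2.head < δ.head) (b, δ))
    (hP : ∀ (b : MvPowerSeries (Fin (2 + 1)) k) (δ : Decoration k 2), Admissible b δ → δ.o = 1 → ¬ δ.HCol → δ.O.Nonempty →
      DBWinsTo (fun τ => Admissible τ.1 τ.2 ∧ (τ.2.head < δ.head ∨ (τ.2.head = δ.head ∧ τ.2.HCol))) (b, δ))
    (hL : ∀ (b : MvPowerSeries (Fin (2 + 1)) k) (δ : Decoration k 2) (l : Fin (2 + 1)), Admissible b δ → δ.o = 1 → ¬ δ.HCol →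
      δ.LetterDir l →
      DBWinsTo (fun τ => Admissible τ.1 τ.2 ∧ (τ.2.head < δ.head ∨ (τ.2.head = δ.head ∧ (τ.2.HCol ∨ τ.2.GoodDir ∨ τ.2.BadDir)))) (b, δ))
    (hB : ∀ (b : MvPowerSeries (Fin (2 + 1)) k) (δ : Decoration k 2), Admissible b δ → δ.o = 1 → ¬ δ.HCol → δ.BadDir →
      DBWinsTo (fun τ => Admissible τ.1 τ.2 ∧ (τ.2.head < δ.head ∨ (τ.2.head = δ.head ∧ (τ.2.HCol ∨ τ.2.GoodDir)))) (b, δ))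
    (b : MvPowerSeries (Fin (2 + 1)) k) (δ : Decoration k 2) (hadm : Admissible b δ) (ho : δ.o = 1) :
    DBWinsTo (fun τ => GermIsNC τ.1 ∨ (Admissible τ.1 τ.2 ∧ τ.2.head < δ.head)) (b, δ) := by
  classical
  let rk : Decoration k 2 → ℕ := fun ε =>
    if ε.HCol then 0 else if ε.O.Nonempty ∨ ε.GoodDir then 1 else if ε.BadDir then 2 else 3
  have rk_hcol : ∀ ε : Decoration k 2, ε.HCol → rk ε = 0 := fun ε h => by
    simp only [rk, if_pos h]
  have rk_good : ∀ ε : Decoration k 2, ε.GoodDir → rk ε ≤ 1 := fun ε h => by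
    simp only [rk]
    split_ifs <;> simp_all
  have rk_bad : ∀ ε : Decoration k 2, ε.BadDir → rk ε ≤ 2 := fun ε h => by
    simp only [rk]
    split_ifs <;> simp_all
  -- a same-head successor keeps order one
  have ho_of_head : ∀ {ε ε' : Decoration k 2}, ε'.head = ε.head → ε.o = 1 → ε'.o = 1 := by
    intro ε ε' hh hε
    rw [Decoration.head, Decoration.head, toLex_inj] at hh
    have hoo : ε'.o = ε.o := (Prod.ext_iff.mp hh).1
    rw [hoo]
    exact hε
  refine onePhaseB_of_step (α := ℕ) (fun τ => rk τ.2) (fun b' δ' hadm' ho' => ?_) b δ hadm ho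
  by_cases hc : δ'.HCol
  · exact (hH b' δ' hadm' ho' hc).mono fun τ hτ => Or.inr ⟨hτ.1, Or.inl hτ.2⟩
  by_cases hgood : δ'.GoodDir
  · -- (T1): a good position of order one is a normal crossing — no move
    exact DBWinsTo.of_target (Or.inl (germIsNC_of_goodDir_of_o_eq_one hadm' ho' hgood))
  by_cases hp : δ'.O.Nonempty
  · have hrk : rk δ' = 1 := by simp only [rk, if_neg hc, if_pos (Or.inl hp)]
    refine (hP b' δ' hadm' ho' hc hp).mono fun τ hτ => Or.inr ⟨hτ.1, hτ.2.imp_right fun h => ⟨h.1, ?_⟩⟩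
    change rk τ.2 < rk δ'
    rw [hrk, rk_hcol τ.2 h.2]
    exact zero_lt_one
  have hnp : ¬ (δ'.O.Nonempty ∨ δ'.GoodDir) := fun h => h.elim hp hgood
  by_cases hb : δ'.BadDir
  · have hrk : rk δ' = 2 := by simp only [rk, if_neg hc, if_neg hnp, if_pos hb]
    refine (hB b' δ' hadm' ho' hc hb).mono fun τ hτ => ?_
    rcases hτ.2 with hlt | ⟨heq, h0 | h1⟩
    · exact Or.inr ⟨hτ.1, Or.inl hlt⟩
    · refine Or.inr ⟨hτ.1, Or.inr ⟨heq, ?_⟩⟩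
      change rk τ.2 < rk δ'
      rw [hrk, rk_hcol τ.2 h0]; exact zero_lt_two
    · exact Or.inl (germIsNC_of_goodDir_of_o_eq_one hτ.1 (ho_of_head heq ho') h1)
  · have hrk : rk δ' = 3 := by simp only [rk, if_neg hc, if_neg hnp, if_neg hb]
    obtain ⟨l, hl⟩ : ∃ l, δ'.LetterDir l := by
      rcases Decoration.regime_split₁ hadm' (by omega) hc with h | h | h | h
      · exact absurd h hp
      · exact absurd h hgood
      · exact absurd h hb
      · exact h
    refine (hL b' δ' l hadm' ho' hc hl).mono fun τ hτ => ?_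
    rcases hτ.2 with hlt | ⟨heq, h0 | h1 | h2⟩
    · exact Or.inr ⟨hτ.1, Or.inl hlt⟩
    · refine Or.inr ⟨hτ.1, Or.inr ⟨heq, ?_⟩⟩
      change rk τ.2 < rk δ'
      rw [hrk, rk_hcol τ.2 h0]; exact zero_lt_three
    · exact Or.inl (germIsNC_of_goodDir_of_o_eq_one hτ.1 (ho_of_head heq ho') h1)
    · refine Or.inr ⟨hτ.1, Or.inr ⟨heq, ?_⟩⟩
      change rk τ.2 < rk δ'
      rw [hrk]
      exact lt_of_le_of_lt (rk_bad τ.2 h2) (by norm_num)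

/-- **THE `o ≤ 1` ENDGAME FROM THE `o = 1` PHASE** ((T0) at `o = 0`). -/
theorem endPhaseB_of_onePhase
    (hone : ∀ (b : MvPowerSeries (Fin (m + 1)) k) (δ : Decoration k m), Admissible b δ → δ.o = 1 →
      DBWinsTo (fun τ => GermIsNC τ.1 ∨ (Admissible τ.1 τ.2 ∧ τ.2.head < δ.head)) (b, δ))
    (b : MvPowerSeries (Fin (m + 1)) k) (δ : Decoration k m) (hadm : Admissible b δ) (ho : δ.o ≤ 1) :
    DBWinsTo (fun τ : MvPowerSeries (Fin (m + 1)) k × Decoration k m => GermIsNC τ.1 ∨ (Admissible τ.1 τ.2 ∧ τ.2.head < δ.head)) (b, δ) := by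
  rcases Nat.lt_or_ge δ.o 1 with h0 | h1
  · exact DBWinsTo.of_target (Or.inl (germIsNC_of_admissible_of_o_eq_zero hadm (by omega)))
  · exact hone b δ hadm (le_antisymm ho h1)

/-! ## D₃ᴮ modulo regimes (P) and (L) at order one -/

/-- **D₃ᴮ MODULO REGIMES (P) (non-empty history) AND (L) AT ORDER ONE** (three letters, `k` algebraically closed of characteristic `p`): every other piece —
regimes (H) (P) (L) (B) at `o ≥ 2`, regimes (H) (B) and the good-position exit at `o = 1`, (T0) at `o = 0`, both assemblies — is a tree theorem in B-form. -/
theorem surfaceBoundaryNC_of_regimesPL₁ (p : ℕ) [Fact p.Prime] [CharP k p] [IsAlgClosed k]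
    (hP₁ : ∀ (b : MvPowerSeries (Fin (2 + 1)) k) (δ : Decoration k 2), Admissible b δ → δ.o = 1 → ¬ δ.HCol → δ.O.Nonempty →
      DBWinsTo (fun τ => Admissible τ.1 τ.2 ∧ (τ.2.head < δ.head ∨ (τ.2.head = δ.head ∧ τ.2.HCol))) (b, δ))
    (hL₁ : ∀ (b : MvPowerSeries (Fin (2 + 1)) k) (δ : Decoration k 2) (l : Fin (2 + 1)), Admissible b δ → δ.o = 1 → ¬ δ.HCol →
      δ.LetterDir l →
      DBWinsTo (fun τ => Admissible τ.1 τ.2 ∧ (τ.2.head < δ.head ∨ (τ.2.head = δ.head ∧ (τ.2.HCol ∨ τ.2.GoodDir ∨ τ.2.BadDir)))) (b, δ))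
    (b : MvPowerSeries (Fin (2 + 1)) k) (δ : Decoration k 2) (hadm : Admissible b δ) :
    DBWinsTo (fun τ : MvPowerSeries (Fin (2 + 1)) k × Decoration k 2 => GermIsNC τ.1) (b, δ) := by
  haveI : Infinite k := IsAlgClosed.instInfinite
  refine surfaceBoundaryNC_of_apexColumnB_of_endB p regimeApexColumnB ?_ b δ hadm
  exact endPhaseB_of_onePhase (onePhaseB_of_regimes (fun b δ hadm ho hcol => regimeApexColumnB₁ b δ hadm (by omega) hcol) hP₁ hL₁
    (fun b δ hadm ho hnc hbad => regimeBadB₁ b δ hadm (by omega) hnc hbad))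

/-- **res-L1-w43-strat-1's `stub_surfaceBoundaryNC₃` MODULO REGIMES (P) AND (L) AT ORDER ONE**, under the stub's own binders. -/
theorem surfaceBoundaryNC₃_of_regimesPL₁
    (hP₁ : ∀ (p : ℕ), p.Prime → ∀ (k : Type) [Field k] [CharP k p] [IsAlgClosed k],
      ∀ (b : MvPowerSeries (Fin 3) k) (δ : Decoration k 2), Admissible b δ → δ.o = 1 → ¬ δ.HCol → δ.O.Nonempty →
        DBWinsTo (fun τ => Admissible τ.1 τ.2 ∧ (τ.2.head < δ.head ∨ (τ.2.head = δ.head ∧ τ.2.HCol))) (b, δ))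
    (hL₁ : ∀ (p : ℕ), p.Prime → ∀ (k : Type) [Field k] [CharP k p] [IsAlgClosed k],
      ∀ (b : MvPowerSeries (Fin 3) k) (δ : Decoration k 2) (l : Fin 3), Admissible b δ → δ.o = 1 → ¬ δ.HCol → δ.LetterDir l →
        DBWinsTo (fun τ => Admissible τ.1 τ.2 ∧ (τ.2.head < δ.head ∨ (τ.2.head = δ.head ∧ (τ.2.HCol ∨ τ.2.GoodDir ∨ τ.2.BadDir)))) (b, δ)) :
    ∀ (p : ℕ), p.Prime → ∀ (k : Type) [Field k] [CharP k p] [IsAlgClosed k],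
      ∀ (b : MvPowerSeries (Fin 3) k) (δ : Decoration k 2), Admissible b δ → δ.O = ∅ →
        DBWinsTo (fun τ : MvPowerSeries (Fin 3) k × Decoration k 2 => GermIsNC τ.1) (b, δ) := by
  intro p hp k _ _ _ b δ hadm _
  haveI : Fact p.Prime := ⟨hp⟩
  exact surfaceBoundaryNC_of_regimesPL₁ p (hP₁ p hp k) (hL₁ p hp k) b δ hadm

end TameFourTupleDrop

end Summit.ResolutionOfSingularities.ResolutionOfSingularities.Theorems

end
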